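import Literature.Probability.LatticeModels.SixVertexSpectralXi
import Literature.Probability.LatticeModels.SixVertexGFFCorrelations
import Mathlib.Analysis.SpecialFunctions.Integrals.Basic

/-!
# Six-vertex spectral measures: scaling limits of `I_F` (DKLM 2026, Part II, proof of Theorem 27)

H. Duminil-Copin, K. K. Kozlowski, P. Lammers, I. Manolescu, *Gaussian free field convergence of
the six-vertex model with `-1 ≤ Δ ≤ -1/2`*, arXiv:2603.06268 (2026) [DKLM2026SixVertexGFF]
(`paper:arxiv-2603.06268`, chunk p0030):

> Using Theorem 46, define `σ, σ' ∈ ℝ_{≥0}` such that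
> `σ²/2π = lim_{s→0} -sI_F'(s) > lim_{s→∞} -sI_F'(s) = (σ')²/2π` (eq:o). From the properties
> in the previous lemma we see that, for any `s ∈ ℝ`, we get
> `lim_{θ→0} I_F(θs) - I_F(θ) = -σ²/2π log s;  lim_{Θ→∞} I_F(Θs) - I_F(Θ) = -(σ')²/2π log s`
> (eq:limit behaviour).

For `μ ∈ 𝓜_{c,C}` and `Ξ(s) = sF(s,0) = -sI_F'(s)` (`SixVertexSpectralXi.lean`; `Ξ` is bounded,
`abs_dklmXi_le`), we prove eq. (limit behaviour) from the mere existence of the limits of `Ξ` at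
`0⁺` and at `∞` (which Theorem 46 provides, `SixVertexSpectralXiMonotone.lean`):

* `dklmIF_mul_sub_dklmIF` — `I_F(θs) - I_F(θ) = -∫_1^s Ξ(θv)/v dv` (`θ, s > 0`);
* **`tendsto_dklmIF_mul_sub_nhdsGT_zero`** — `lim_{θ→0⁺} I_F(θs) - I_F(θ) = -L₀ log s` when
  `Ξ → L₀` at `0⁺`;
* **`tendsto_dklmIF_mul_sub_atTop`** — `lim_{Θ→∞} I_F(Θs) - I_F(Θ) = -L_∞ log s` when
  `Ξ → L_∞` at `∞` (dominated convergence on `[1,s]`, dominating function `sup|Ξ| / v`);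
* `tendsto_fourTerm_dklmIF_nhdsGT_zero` / `_atTop` and **`tendsto_dklmIF_config_nhdsGT_zero` /
  `_atTop`** — the right-hand side of eq. (Psi_in_terms_of_I),
  `I_F(|u₂-u₁|) + I_F(|u₂'-u₁'|) - I_F(|u₂-u₁'|) - I_F(|u₂'-u₁|)`, evaluated at `θu` tends to
  `2πL₀ · Ψ₂^GFF(u)` as `θ → 0⁺` (resp. `2πL_∞ Ψ₂^GFF(u)` as `θ → ∞`): eq. (two limits of Phi)
  with `σ² = 2πL₀`, `(σ')² = 2πL_∞`, given Lemma 38 (ii).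

## References

* H. Duminil-Copin, K. K. Kozlowski, P. Lammers, I. Manolescu, arXiv:2603.06268 (2026), Part II,
  proof of Theorem 27, eq. (eq:o), (eq:limit behaviour) and (eq:two limits of Phi); Lemma 38 (ii).
  [DKLM2026SixVertexGFF]
-/

noncomputable section

open MeasureTheory Set Filter Topology intervalIntegral

namespace Literature.Probability.LatticeModels.SixVertex

variable {c C : ℝ} {μ : Measure (ℝ × ℝ)}

/-- `x ↦ F(x,0)` is interval integrable on every `[a,b] ⊂ (0,∞)`. [cite: DKLM2026SixVertexGFF, Part II, Definition 36] -/
theorem intervalIntegrable_dklmF_re (h : μ ∈ dklmSpaceM c C) {a b : ℝ} (ha : 0 < a) (hb : 0 < b) :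
    IntervalIntegrable (fun x : ℝ => (dklmF μ x 0).re) volume a b := by
  refine ((continuousOn_dklmF_re h).mono fun x hx => ?_).intervalIntegrable
  rw [mem_Ioi]
  rcases le_total a b with hab | hab
  · rw [uIcc_of_le hab] at hx; linarith [hx.1]
  · rw [uIcc_of_ge hab] at hx; linarith [hx.1]

/-- **`I_F(θs) - I_F(θ) = -∫_1^s Ξ(θv)/v dv`** for `θ, s > 0` (`I_F(b) - I_F(a) = -∫_a^b F(x,0) dx`
and the substitution `x = θv`, `θ F(θv,0) = Ξ(θv)/v`).
[cite: DKLM2026SixVertexGFF, Part II, proof of Theorem 27, eq. (limit behaviour)] -/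
theorem dklmIF_mul_sub_dklmIF (h : μ ∈ dklmSpaceM c C) {θ s : ℝ} (hθ : 0 < θ) (hs : 0 < s) :
    dklmIF μ (θ * s) - dklmIF μ θ = -∫ v in (1 : ℝ)..s, dklmXi μ (θ * v) / v := by
  have hθs : 0 < θ * s := mul_pos hθ hs
  -- `I_F(θs) - I_F(θ) = -∫_θ^{θs} F`
  have h1 : dklmIF μ (θ * s) - dklmIF μ θ = -∫ x in θ..θ * s, (dklmF μ x 0).re := by
    rw [dklmIF, dklmIF, neg_sub_neg, intervalIntegral.integral_interval_sub_left
      (intervalIntegrable_dklmF_re h one_pos hθ) (intervalIntegrable_dklmF_re h one_pos hθs),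
      intervalIntegral.integral_symm]
  -- substitution `x = θ v`
  have h2 : ∫ x in θ..θ * s, (dklmF μ x 0).re = θ * ∫ v in (1 : ℝ)..s, (dklmF μ ((θ * v : ℝ) : ℂ) 0).re := by
    have := intervalIntegral.integral_comp_mul_left (fun x : ℝ => (dklmF μ x 0).re) (c := θ) hθ.ne' (a := 1) (b := s)
    rw [mul_one] at this
    rw [this, smul_eq_mul, ← mul_assoc, mul_inv_cancel₀ hθ.ne', one_mul]
  rw [h1, h2, ← intervalIntegral.integral_const_mul]
  congr 1
  refine intervalIntegral.integral_congr fun v hv => ?_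
  have hv0 : 0 < v := by
    rcases le_total 1 s with h1s | h1s
    · rw [uIcc_of_le h1s] at hv; linarith [hv.1]
    · rw [uIcc_of_ge h1s] at hv; linarith [hv.1]
  simp only [dklmXi]
  field_simp

/-- `v ↦ Ξ(θv)/v` is continuous on `(0,∞)` for `θ > 0`. [cite: DKLM2026SixVertexGFF, Part II §1.5] -/
theorem continuousOn_dklmXi_comp_div (h : μ ∈ dklmSpaceM c C) {θ : ℝ} (hθ : 0 < θ) :
    ContinuousOn (fun v : ℝ => dklmXi μ (θ * v) / v) (Ioi 0) := by
  have hF : ContinuousOn (fun v : ℝ => (dklmF μ ((θ * v : ℝ) : ℂ) 0).re) (Ioi 0) :=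
    (continuousOn_dklmF_re h).comp (continuousOn_const.mul continuousOn_id) fun v hv => mul_pos hθ hv
  have hΞ : ContinuousOn (fun v : ℝ => dklmXi μ (θ * v)) (Ioi 0) := by
    simp only [dklmXi]
    exact (continuousOn_const.mul continuousOn_id).mul hF
  exact hΞ.div continuousOn_id fun v hv => ne_of_gt hv

/-- The dominated-convergence core: if `Ξ(θ_i v) → L` for every `v > 0` along a filter `l` on the
parameters `θ_i > 0`, then `∫_1^s Ξ(θ_i v)/v dv → L log s` (dominating function `sup|Ξ| / v`).
[cite: DKLM2026SixVertexGFF, Part II, proof of Theorem 27, eq. (limit behaviour)] -/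
theorem tendsto_integral_dklmXi_div (h : μ ∈ dklmSpaceM c C) {ι : Type*} {l : Filter ι} [l.IsCountablyGenerated]
    {θ : ι → ℝ} (hθ : ∀ i, 0 < θ i) {L : ℝ} (hlim : ∀ v : ℝ, 0 < v → Tendsto (fun i => dklmXi μ (θ i * v)) l (𝓝 L))
    {s : ℝ} (hs : 0 < s) :
    Tendsto (fun i => ∫ v in (1 : ℝ)..s, dklmXi μ (θ i * v) / v) l (𝓝 (L * Real.log s)) := by
  set M : ℝ := 24 * max C 0 with hM
  have hpos : ∀ v ∈ uIoc (1 : ℝ) s, 0 < v := by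
    intro v hv
    rcases le_total 1 s with h1s | h1s
    · rw [uIoc_of_le h1s] at hv; linarith [hv.1]
    · rw [uIoc_of_ge h1s] at hv; linarith [hv.1]
  have hpos' : ∀ v ∈ uIcc (1 : ℝ) s, 0 < v := by
    intro v hv
    rcases le_total 1 s with h1s | h1s
    · rw [uIcc_of_le h1s] at hv; linarith [hv.1]
    · rw [uIcc_of_ge h1s] at hv; linarith [hv.1]
  have hlim_int : Tendsto (fun i => ∫ v in (1 : ℝ)..s, dklmXi μ (θ i * v) / v) l (𝓝 (∫ v in (1 : ℝ)..s, L / v)) := by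
    refine intervalIntegral.tendsto_integral_filter_of_dominated_convergence (fun v => M / v) ?_ ?_ ?_ ?_
    · refine Eventually.of_forall fun i => ?_
      exact ((continuousOn_dklmXi_comp_div h (hθ i)).mono fun v hv => hpos v hv).aestronglyMeasurable
        measurableSet_uIoc
    · refine Eventually.of_forall fun i => ae_of_all _ fun v hv => ?_
      have hv := hpos v hv
      rw [norm_div, Real.norm_eq_abs, Real.norm_eq_abs, abs_of_pos hv]
      exact div_le_div_of_nonneg_right (abs_dklmXi_le h (mul_pos (hθ i) hv)) hv.le
    · exact (continuousOn_const.div continuousOn_id fun v hv => ne_of_gt (hpos' v hv)).intervalIntegrable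
    · exact ae_of_all _ fun v hv => (hlim v (hpos v hv)).div_const v
  have hval : ∫ v in (1 : ℝ)..s, L / v = L * Real.log s := by
    simp_rw [div_eq_mul_inv]
    rw [intervalIntegral.integral_const_mul, integral_inv (fun h0 => ?_), div_one]
    exact lt_irrefl (0 : ℝ) (hpos' 0 h0)
  rwa [hval] at hlim_int

/-- **eq. (limit behaviour), zooming in**: if `Ξ(s) → L₀` as `s → 0⁺` (`L₀ = σ²/2π`, eq. (eq:o)),
then `I_F(θs) - I_F(θ) → -L₀ log s` as `θ → 0⁺`, for every `s > 0`.
[cite: DKLM2026SixVertexGFF, Part II, proof of Theorem 27, eq. (limit behaviour)] -/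
theorem tendsto_dklmIF_mul_sub_nhdsGT_zero (h : μ ∈ dklmSpaceM c C) {L₀ : ℝ}
    (hΞ : Tendsto (dklmXi μ) (𝓝[>] 0) (𝓝 L₀)) {s : ℝ} (hs : 0 < s) :
    Tendsto (fun θ : ℝ => dklmIF μ (θ * s) - dklmIF μ θ) (𝓝[>] 0) (𝓝 (-(L₀ * Real.log s))) := by
  -- work with the subtype of positive parameters through `tendsto_nhdsWithin`
  have key : Tendsto (fun θ : ℝ => -∫ v in (1 : ℝ)..s, dklmXi μ (θ * v) / v) (𝓝[>] 0) (𝓝 (-(L₀ * Real.log s))) := by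
    refine Tendsto.neg ?_
    -- restrict the filter to `Ioi 0` via the inclusion `ι = {θ // 0 < θ}`
    rw [← map_coe_Ioi_atBot (0 : ℝ)] at hΞ ⊢
    rw [tendsto_map'_iff] at hΞ ⊢
    refine tendsto_integral_dklmXi_div h (ι := Ioi (0 : ℝ)) (l := atBot) (θ := fun i => (i : ℝ)) (fun i => i.2) ?_ hs
    intro v hv
    -- `θ v → 0⁺` as `θ → 0⁺`
    have hmap : Tendsto (fun i : Ioi (0 : ℝ) => (⟨(i : ℝ) * v, mul_pos i.2 hv⟩ : Ioi (0 : ℝ))) atBot atBot := by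
      refine tendsto_atBot_atBot.2 fun b => ⟨⟨(b : ℝ) / v, div_pos b.2 hv⟩, fun a ha => ?_⟩
      change (a : ℝ) * v ≤ (b : ℝ)
      have : (a : ℝ) ≤ (b : ℝ) / v := ha
      rwa [le_div_iff₀ hv] at this
    exact hΞ.comp hmap
  refine key.congr' ?_
  filter_upwards [self_mem_nhdsWithin] with θ hθ
  rw [dklmIF_mul_sub_dklmIF h hθ hs]

/-- **eq. (limit behaviour), zooming out**: if `Ξ(s) → L_∞` as `s → ∞` (`L_∞ = (σ')²/2π`), then
`I_F(Θs) - I_F(Θ) → -L_∞ log s` as `Θ → ∞`, for every `s > 0`.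
[cite: DKLM2026SixVertexGFF, Part II, proof of Theorem 27, eq. (limit behaviour)] -/
theorem tendsto_dklmIF_mul_sub_atTop (h : μ ∈ dklmSpaceM c C) {Linf : ℝ}
    (hΞ : Tendsto (dklmXi μ) atTop (𝓝 Linf)) {s : ℝ} (hs : 0 < s) :
    Tendsto (fun Θ : ℝ => dklmIF μ (Θ * s) - dklmIF μ Θ) atTop (𝓝 (-(Linf * Real.log s))) := by
  have key : Tendsto (fun Θ : ℝ => -∫ v in (1 : ℝ)..s, dklmXi μ (Θ * v) / v) atTop (𝓝 (-(Linf * Real.log s))) := by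
    refine Tendsto.neg ?_
    rw [← Filter.map_val_Ioi_atTop (0 : ℝ), tendsto_map'_iff]
    refine tendsto_integral_dklmXi_div h (ι := Ioi (0 : ℝ)) (l := atTop) (θ := fun i => (i : ℝ)) (fun i => i.2) ?_ hs
    intro v hv
    have h1 : Tendsto (fun i : Ioi (0 : ℝ) => (i : ℝ) * v) atTop atTop :=
      (tendsto_atTop_atTop.2 fun b => ⟨⟨max b 1, mem_Ioi.2 (lt_max_of_lt_right one_pos)⟩,
        fun a ha => (le_max_left b 1).trans ha⟩).atTop_mul_const hv
    exact hΞ.comp h1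
  refine key.congr' ?_
  filter_upwards [eventually_gt_atTop 0] with Θ hΘ
  rw [dklmIF_mul_sub_dklmIF h hΘ hs]

/-! ## The four-term combination of eq. (Psi_in_terms_of_I) under scaling -/

/-- **Four-term scaling limit, zooming in**: for `r₁, r₂, r₃, r₄ > 0`,
`I_F(θr₁) + I_F(θr₂) - I_F(θr₃) - I_F(θr₄) → -L₀ (log r₁ + log r₂ - log r₃ - log r₄)` as
`θ → 0⁺` (subtract `I_F(θ)` from each term). [cite: DKLM2026SixVertexGFF, Part II, proof of Theorem 27, eq. (two limits of Phi)] -/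
theorem tendsto_fourTerm_dklmIF_nhdsGT_zero (h : μ ∈ dklmSpaceM c C) {L₀ : ℝ}
    (hΞ : Tendsto (dklmXi μ) (𝓝[>] 0) (𝓝 L₀)) {r₁ r₂ r₃ r₄ : ℝ} (h₁ : 0 < r₁) (h₂ : 0 < r₂) (h₃ : 0 < r₃)
    (h₄ : 0 < r₄) :
    Tendsto (fun θ : ℝ => dklmIF μ (θ * r₁) + dklmIF μ (θ * r₂) - dklmIF μ (θ * r₃) - dklmIF μ (θ * r₄)) (𝓝[>] 0)
      (𝓝 (-(L₀ * (Real.log r₁ + Real.log r₂ - Real.log r₃ - Real.log r₄)))) := by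
  have key := ((tendsto_dklmIF_mul_sub_nhdsGT_zero h hΞ h₁).add (tendsto_dklmIF_mul_sub_nhdsGT_zero h hΞ h₂)).sub
    ((tendsto_dklmIF_mul_sub_nhdsGT_zero h hΞ h₃).add (tendsto_dklmIF_mul_sub_nhdsGT_zero h hΞ h₄))
  refine (key.congr fun θ => by ring).trans ?_
  rw [show -(L₀ * Real.log r₁) + -(L₀ * Real.log r₂) - (-(L₀ * Real.log r₃) + -(L₀ * Real.log r₄)) =
    -(L₀ * (Real.log r₁ + Real.log r₂ - Real.log r₃ - Real.log r₄)) by ring]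

/-- **Four-term scaling limit, zooming out** (`θ → ∞`). [cite: DKLM2026SixVertexGFF, Part II, proof of Theorem 27, eq. (two limits of Phi)] -/
theorem tendsto_fourTerm_dklmIF_atTop (h : μ ∈ dklmSpaceM c C) {Linf : ℝ}
    (hΞ : Tendsto (dklmXi μ) atTop (𝓝 Linf)) {r₁ r₂ r₃ r₄ : ℝ} (h₁ : 0 < r₁) (h₂ : 0 < r₂) (h₃ : 0 < r₃)
    (h₄ : 0 < r₄) :
    Tendsto (fun θ : ℝ => dklmIF μ (θ * r₁) + dklmIF μ (θ * r₂) - dklmIF μ (θ * r₃) - dklmIF μ (θ * r₄)) atTop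
      (𝓝 (-(Linf * (Real.log r₁ + Real.log r₂ - Real.log r₃ - Real.log r₄)))) := by
  have key := ((tendsto_dklmIF_mul_sub_atTop h hΞ h₁).add (tendsto_dklmIF_mul_sub_atTop h hΞ h₂)).sub
    ((tendsto_dklmIF_mul_sub_atTop h hΞ h₃).add (tendsto_dklmIF_mul_sub_atTop h hΞ h₄))
  refine (key.congr fun θ => by ring).trans ?_
  rw [show -(Linf * Real.log r₁) + -(Linf * Real.log r₂) - (-(Linf * Real.log r₃) + -(Linf * Real.log r₄)) =
    -(Linf * (Real.log r₁ + Real.log r₂ - Real.log r₃ - Real.log r₄)) by ring]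

/-- The logarithms of the four distances of a configuration `u = (u₁,u₁',u₂,u₂')` with pairwise
distinct relevant points combine to `-2π Ψ₂^GFF(u)`:
`log|u₂-u₁| + log|u₂'-u₁'| - log|u₂-u₁'| - log|u₂'-u₁| = -2π Ψ₂^GFF(u)` (Definition 2.6 with
`G = -(1/2π) log|·|`). [cite: DKLM2026SixVertexGFF, Definition 2.6 and Remark 39] -/
theorem log_fourTerm_eq_gffKPoint (u : Fin 2 → ℂ × ℂ) :
    Real.log ‖(u 1).1 - (u 0).1‖ + Real.log ‖(u 1).2 - (u 0).2‖ - Real.log ‖(u 1).1 - (u 0).2‖ -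
      Real.log ‖(u 1).2 - (u 0).1‖ = -(2 * Real.pi) * gffKPoint 2 u := by
  rw [gffKPoint_two]
  simp only [greenPlane]
  field_simp
  ring

/-- **eq. (two limits of Phi), zooming in**: the right-hand side of eq. (Psi_in_terms_of_I)
(Lemma 38 (ii)) at the scaled configuration `θu`,
`I_F(θ|u₂-u₁|) + I_F(θ|u₂'-u₁'|) - I_F(θ|u₂-u₁'|) - I_F(θ|u₂'-u₁|)`, tends to `2πL₀ · Ψ₂^GFF(u)`
as `θ → 0⁺` — i.e. to `σ² Ψ₂^GFF(u)` with `σ²/2π = L₀ = lim_{0⁺} Ξ`.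
[cite: DKLM2026SixVertexGFF, Part II, proof of Theorem 27, eq. (two limits of Phi)] -/
theorem tendsto_dklmIF_config_nhdsGT_zero (h : μ ∈ dklmSpaceM c C) {L₀ : ℝ}
    (hΞ : Tendsto (dklmXi μ) (𝓝[>] 0) (𝓝 L₀)) (u : Fin 2 → ℂ × ℂ) (h₁ : (u 1).1 ≠ (u 0).1)
    (h₂ : (u 1).2 ≠ (u 0).2) (h₃ : (u 1).1 ≠ (u 0).2) (h₄ : (u 1).2 ≠ (u 0).1) :
    Tendsto (fun θ : ℝ => dklmIF μ (θ * ‖(u 1).1 - (u 0).1‖) + dklmIF μ (θ * ‖(u 1).2 - (u 0).2‖) -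
        dklmIF μ (θ * ‖(u 1).1 - (u 0).2‖) - dklmIF μ (θ * ‖(u 1).2 - (u 0).1‖)) (𝓝[>] 0)
      (𝓝 (2 * Real.pi * L₀ * gffKPoint 2 u)) := by
  have key := tendsto_fourTerm_dklmIF_nhdsGT_zero h hΞ (norm_pos_iff.2 (sub_ne_zero.2 h₁))
    (norm_pos_iff.2 (sub_ne_zero.2 h₂)) (norm_pos_iff.2 (sub_ne_zero.2 h₃)) (norm_pos_iff.2 (sub_ne_zero.2 h₄))
  rw [log_fourTerm_eq_gffKPoint] at key
  convert key using 2
  ring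

/-- **eq. (two limits of Phi), zooming out** (`θ → ∞`, limit `2πL_∞ Ψ₂^GFF(u) = (σ')² Ψ₂^GFF(u)`).
[cite: DKLM2026SixVertexGFF, Part II, proof of Theorem 27, eq. (two limits of Phi)] -/
theorem tendsto_dklmIF_config_atTop (h : μ ∈ dklmSpaceM c C) {Linf : ℝ}
    (hΞ : Tendsto (dklmXi μ) atTop (𝓝 Linf)) (u : Fin 2 → ℂ × ℂ) (h₁ : (u 1).1 ≠ (u 0).1)
    (h₂ : (u 1).2 ≠ (u 0).2) (h₃ : (u 1).1 ≠ (u 0).2) (h₄ : (u 1).2 ≠ (u 0).1) :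
    Tendsto (fun θ : ℝ => dklmIF μ (θ * ‖(u 1).1 - (u 0).1‖) + dklmIF μ (θ * ‖(u 1).2 - (u 0).2‖) -
        dklmIF μ (θ * ‖(u 1).1 - (u 0).2‖) - dklmIF μ (θ * ‖(u 1).2 - (u 0).1‖)) atTop
      (𝓝 (2 * Real.pi * Linf * gffKPoint 2 u)) := by
  have key := tendsto_fourTerm_dklmIF_atTop h hΞ (norm_pos_iff.2 (sub_ne_zero.2 h₁))
    (norm_pos_iff.2 (sub_ne_zero.2 h₂)) (norm_pos_iff.2 (sub_ne_zero.2 h₃)) (norm_pos_iff.2 (sub_ne_zero.2 h₄))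
  rw [log_fourTerm_eq_gffKPoint] at key
  convert key using 2
  ring

end Literature.Probability.LatticeModels.SixVertex

end
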